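import Mathlib

/-!
# Axisymmetric tangent cones of self-similar Euler profiles: kernel lemmas (K16)

Solo seat `solo-NavierStokesRegularity-informed`, session 11; companion of the note
`paper/axisymmetric-cones.md` (Theorem 6: an axisymmetric, locally Lipschitz, 1-homogeneous solution
`C = r (u(φ) e_r + v(φ) e_φ + s(φ) e_α)` of the cone equation `C + (C·∇)C + ∇π = 0`, `div C = 0`
feeds no vorticity into a sub-Leray (`γ < 1/2`) self-similar profile).

What is certified here (pure real analysis / arithmetic, no new definitions):

* `swirlCone_dichotomy` — Theorem 6(a): the azimuthal component
  `s + 2us + v s' + v s cot φ = 0` of the cone equation, evaluated on an invariant cone (`v = 0`),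
  forces `s = 0 ∨ u = -1/2`: a cone carrying swirl sits exactly at the Leray strain `-1/2`.
* `attractingCone_strain_nonpos` — the sign step of Theorem 6(b) from `div C = 0`
  (`3u + v' + v cot φ = 0`): at a zero of `v` with `v' ≥ 0`, `u ≤ 0`.
* `helicityDensity_eq_mul_vorticity` — on a swirl-free sector, `f = 2 v² - v u' = v · (2v - u')`,
  i.e. the Lamb-vector density is `v` times the azimuthal vorticity.
* `charCone_weight_antitoneOn`, `charCone_bounded_eq_zero` — Lemma 6.1 (blow-up at a
  characteristic cone): if `v g' = -k g` on `(0, δ]` with `k ≥ k₀ > 0` and `0 < v ≤ L ψ`, then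
  `ψ ↦ ψ (g ψ · g ψ)^(n+1)` is antitone once `L ≤ 2 (n+1) k₀`, and a bounded such `g` vanishes
  identically. (Applied to the swirl `s` and to `f`, this is why attracting sectors are potential.)
* `attractingCone_rate_lt`, `attractingPole_rate_lt`, `swirlCone_radial_rate_neg`,
  `cauchyDecay_exponent_pos` — the rate arithmetic of Theorem 6(c) / Proposition 9.
-/

namespace Summit.NavierStokesRegularity.NavierStokesRegularity.Theorems

/-- Theorem 6(a) of `axisymmetric-cones.md`: on an invariant cone (`v = 0`) the azimuthal cone
equation `s + 2us + v s' + v s cot φ = 0` gives `s (1 + 2u) = 0`. -/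
theorem swirlCone_dichotomy {u v s ds cotφ : ℝ}
    (h : s + 2 * u * s + v * ds + v * s * cotφ = 0) (hv : v = 0) :
    s = 0 ∨ u = -1 / 2 := by
  subst hv
  have hs : s * (1 + 2 * u) = 0 := by linear_combination h
  rcases mul_eq_zero.mp hs with h0 | h1
  · exact Or.inl h0
  · right; linarith

/-- Sign step of Theorem 6(b): from `div C = 0` in the form `3u + v' + v cot φ = 0`, at a zero of `v`
that attracts the reversed sphere flow from above (`v' ≥ 0` there), the normal strain is `≤ 0`. -/
theorem attractingCone_strain_nonpos {u v dv cotφ : ℝ}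
    (hdiv : 3 * u + dv + v * cotφ = 0) (hv : v = 0) (hdv : 0 ≤ dv) : u ≤ 0 := by
  subst hv
  linarith

/-- On a swirl-free sector (`s = 0`) the density `f = 2 (v² + s²) - v u'` factors as
`v · ω` with `ω = 2v - u'` the azimuthal vorticity of `C = r (u e_r + v e_φ)`. -/
theorem helicityDensity_eq_mul_vorticity {u' v s : ℝ} (hs : s = 0) :
    2 * (v ^ 2 + s ^ 2) - v * u' = v * (2 * v - u') := by
  subst hs; ring

/-- Lemma 6.1 (monotone weight). If `v g' = -k g` on `(0, δ]` with `k ≥ k₀ > 0`, `0 < v ψ ≤ L ψ`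
and `L ≤ 2 (n+1) k₀`, then `ψ ↦ ψ · (g ψ · g ψ)^(n+1)` is antitone on `(0, δ]`. -/
theorem charCone_weight_antitoneOn
    {g g' v k : ℝ → ℝ} {δ k₀ L : ℝ} {n : ℕ}
    (hn : L ≤ 2 * (n + 1) * k₀)
    (hg : ∀ ψ ∈ Set.Ioc (0 : ℝ) δ, HasDerivAt g (g' ψ) ψ)
    (hv : ∀ ψ ∈ Set.Ioc (0 : ℝ) δ, 0 < v ψ ∧ v ψ ≤ L * ψ)
    (hk : ∀ ψ ∈ Set.Ioc (0 : ℝ) δ, k₀ ≤ k ψ)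
    (hode : ∀ ψ ∈ Set.Ioc (0 : ℝ) δ, v ψ * g' ψ = -(k ψ * g ψ)) :
    AntitoneOn (fun ψ => ψ * (g ψ * g ψ) ^ (n + 1)) (Set.Ioc 0 δ) := by
  have hderiv : ∀ ψ ∈ Set.Ioc (0 : ℝ) δ,
      HasDerivAt (fun ψ => ψ * (g ψ * g ψ) ^ (n + 1))
        (1 * (g ψ * g ψ) ^ (n + 1)
          + ψ * (((n + 1 : ℕ) : ℝ) * (g ψ * g ψ) ^ (n + 1 - 1) * (g' ψ * g ψ + g ψ * g' ψ))) ψ := by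
    intro ψ hψ
    exact (hasDerivAt_id' ψ).mul (((hg ψ hψ).mul (hg ψ hψ)).pow (n + 1))
  apply antitoneOn_of_deriv_nonpos (convex_Ioc 0 δ)
  · intro ψ hψ
    exact (hderiv ψ hψ).continuousAt.continuousWithinAt
  · rw [interior_Ioc]
    intro ψ hψ
    exact (hderiv ψ (Set.Ioo_subset_Ioc_self hψ)).differentiableAt.differentiableWithinAt
  · rw [interior_Ioc]
    intro ψ hψ
    have hψ' : ψ ∈ Set.Ioc (0 : ℝ) δ := Set.Ioo_subset_Ioc_self hψ
    have hψpos : 0 < ψ := hψ.1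
    rw [(hderiv ψ hψ').deriv]
    simp only [Nat.add_sub_cancel, Nat.cast_add, Nat.cast_one, one_mul]
    set q : ℝ := g ψ * g ψ with hq_def
    have hq : 0 ≤ q := mul_self_nonneg _
    -- the bracket X := q + ψ (n+1) (g' g + g g') is ≤ 0
    have hvpos : 0 < v ψ := (hv ψ hψ').1
    have hvle : v ψ ≤ L * ψ := (hv ψ hψ').2
    have hkψ : k₀ ≤ k ψ := hk ψ hψ'
    have hX : q + ψ * ((n + 1 : ℝ) * (g' ψ * g ψ + g ψ * g' ψ)) ≤ 0 := by
      have h1 : v ψ * (q + ψ * ((n + 1 : ℝ) * (g' ψ * g ψ + g ψ * g' ψ)))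
          = q * (v ψ - 2 * (n + 1) * ψ * k ψ) := by
        have : v ψ * (q + ψ * ((n + 1 : ℝ) * (g' ψ * g ψ + g ψ * g' ψ)))
            = q * v ψ + 2 * (n + 1) * ψ * (g ψ * (v ψ * g' ψ)) := by rw [hq_def]; ring
        rw [this, hode ψ hψ', hq_def]; ring
      have h2 : v ψ - 2 * (n + 1) * ψ * k ψ ≤ 0 := by
        have hψk : ψ * k₀ ≤ ψ * k ψ := mul_le_mul_of_nonneg_left hkψ hψpos.le
        have hn1 : (0 : ℝ) ≤ 2 * (n + 1) := by positivity
        nlinarith [mul_le_mul_of_nonneg_left hψk hn1, mul_le_mul_of_nonneg_left hn hψpos.le]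
      have h3 : v ψ * (q + ψ * ((n + 1 : ℝ) * (g' ψ * g ψ + g ψ * g' ψ))) ≤ 0 := by
        rw [h1]; exact mul_nonpos_of_nonneg_of_nonpos hq h2
      by_contra hcon
      push Not at hcon
      have := mul_pos hvpos hcon
      linarith
    have hfac : q ^ (n + 1) + ψ * ((↑n + 1) * q ^ n * (g' ψ * g ψ + g ψ * g' ψ))
        = q ^ n * (q + ψ * ((n + 1 : ℝ) * (g' ψ * g ψ + g ψ * g' ψ))) := by ring
    rw [hfac]
    exact mul_nonpos_of_nonneg_of_nonpos (pow_nonneg hq n) hX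

/-- Lemma 6.1 (blow-up at a characteristic cone): under the hypotheses of
`charCone_weight_antitoneOn`, a solution bounded on `(0, δ]` vanishes identically there. -/
theorem charCone_bounded_eq_zero
    {g g' v k : ℝ → ℝ} {δ k₀ L M : ℝ} {n : ℕ}
    (hn : L ≤ 2 * (n + 1) * k₀)
    (hg : ∀ ψ ∈ Set.Ioc (0 : ℝ) δ, HasDerivAt g (g' ψ) ψ)
    (hv : ∀ ψ ∈ Set.Ioc (0 : ℝ) δ, 0 < v ψ ∧ v ψ ≤ L * ψ)
    (hk : ∀ ψ ∈ Set.Ioc (0 : ℝ) δ, k₀ ≤ k ψ)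
    (hode : ∀ ψ ∈ Set.Ioc (0 : ℝ) δ, v ψ * g' ψ = -(k ψ * g ψ))
    (hM : ∀ ψ ∈ Set.Ioc (0 : ℝ) δ, |g ψ| ≤ M) :
    ∀ ψ ∈ Set.Ioc (0 : ℝ) δ, g ψ = 0 := by
  intro ψ₀ hψ₀
  by_contra hne
  have hA := charCone_weight_antitoneOn (n := n) hn hg hv hk hode
  set B : ℝ := (M * M) ^ (n + 1) with hB_def
  have hB : 0 ≤ B := pow_nonneg (mul_self_nonneg M) _
  set c₀ : ℝ := ψ₀ * (g ψ₀ * g ψ₀) ^ (n + 1) with hc₀_def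
  have hc₀ : 0 < c₀ := mul_pos hψ₀.1 (pow_pos (mul_self_pos.mpr hne) _)
  have hD : 0 < 2 * (B + 1) := by positivity
  set ψ₁ : ℝ := min ψ₀ (c₀ / (2 * (B + 1))) with hψ₁_def
  have hψ₁pos : 0 < ψ₁ := lt_min hψ₀.1 (div_pos hc₀ hD)
  have hψ₁le : ψ₁ ≤ ψ₀ := min_le_left _ _
  have hψ₁mem : ψ₁ ∈ Set.Ioc (0 : ℝ) δ := ⟨hψ₁pos, hψ₁le.trans hψ₀.2⟩
  have hmono : c₀ ≤ ψ₁ * (g ψ₁ * g ψ₁) ^ (n + 1) := hA hψ₁mem hψ₀ hψ₁le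
  have hq1 : (g ψ₁ * g ψ₁) ^ (n + 1) ≤ B := by
    have h := mul_self_le_mul_self (abs_nonneg _) (hM ψ₁ hψ₁mem)
    rw [abs_mul_abs_self] at h
    exact pow_le_pow_left₀ (mul_self_nonneg _) h (n + 1)
  have h1 : c₀ ≤ ψ₁ * B := hmono.trans (mul_le_mul_of_nonneg_left hq1 hψ₁pos.le)
  have h2 : ψ₁ * B ≤ c₀ / (2 * (B + 1)) * B := mul_le_mul_of_nonneg_right (min_le_right _ _) hB
  have h3 : c₀ / (2 * (B + 1)) * B < c₀ := by
    calc c₀ / (2 * (B + 1)) * B = c₀ * (B / (2 * (B + 1))) := by ring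
      _ < c₀ * 1 := by
          apply mul_lt_mul_of_pos_left _ hc₀
          rw [div_lt_one hD]; linarith
      _ = c₀ := mul_one _
  linarith

/-- Theorem 6(c), interior attracting cone: the spectrum of `DC` there is `{c, c, -2c}` with
`-γ < c ≤ 0`; the linearised forward stretching exponent `γ + max(c, -2c)` is `< 3γ < 1 + γ`. -/
theorem attractingCone_rate_lt {γ c : ℝ} (hγ : γ < 1 / 2) (hc₁ : -γ < c) (hc₂ : c ≤ 0) :
    γ + max c (-2 * c) < 3 * γ ∧ 3 * γ < 1 + γ := by
  constructor
  · rw [max_eq_right (by linarith)]; linarith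
  · linarith

/-- Theorem 6(c), attracting pole: the spectrum of `DC` on the polar cap is `{c, -c/2, -c/2}` with
`-γ < c ≤ 0`; the exponent `γ + max(c, -c/2)` is `< 3γ/2 ≤ 3γ < 1 + γ`. -/
theorem attractingPole_rate_lt {γ c : ℝ} (hγ : γ < 1 / 2) (hc₁ : -γ < c) (hc₂ : c ≤ 0) :
    γ + max c (-c / 2) < 3 * γ ∧ 3 * γ < 1 + γ := by
  constructor
  · rw [max_eq_right (by linarith)]; linarith
  · linarith

/-- Theorem 6(a)+(c): a swirling cone has normal strain `-1/2`, so the backward radial rate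
`-(γ + c) = 1/2 - γ` is positive for `γ < 1/2`: such cones expel the backward flow. -/
theorem swirlCone_radial_rate_neg {γ c : ℝ} (hγ : γ < 1 / 2) (hc : c = -1 / 2) : γ + c < 0 := by
  subst hc; linarith

/-- Proposition 9, last step: with stretching exponent `γ + λ⁺ + ε`, `λ⁺ < 2γ`, `ε < 1 - 2γ`, the Cauchy
bound `|Ω(y)| ≤ K e^{-(1+γ)t} e^{(γ+λ⁺+ε)t}` decays: the exponent `(1 + γ) - (γ + λ⁺ + ε)` is positive. -/
theorem cauchyDecay_exponent_pos {γ lam ε : ℝ} (hlam : lam < 2 * γ) (hε : ε < 1 - 2 * γ) :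
    0 < (1 + γ) - (γ + lam + ε) := by
  linarith

end Summit.NavierStokesRegularity.NavierStokesRegularity.Theorems
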